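import Summits.QuantumAdvantage.QuantumAdvantage.Theorems.SosSandwichTransferPBEventMachineDefs
import HarnessLib

/-!
# Crux `TransferPB` (stmt-QuantumAdvantage-15238, route SosSandwich), line `birth` — RUNS of the event-driven state machine

For the event machine of `Theorems/SosSandwichTransferPBEventMachineDefs.lean` (`evDelta`, `evKappa`, `evInit`,
`evLoop`: a state machine consuming ONE answer bit per transition — the `OSM` shape of
`Literature/Computability/Complexity/OracleStateMachine.lean`, whose polynomial time is free from three `FP` maps):

* `evLoop_single_zero`, `evLoop_single_succ`, `evLoop_levels` — the level scan enumerates the heavy-prefix descent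
  (`children`/`levelsFrom` = the next values of `liveLevel`, `levelsFrom_liveLevel`) keeping the running least candidate
  (`bestFold`), which is `List.argmin strNum` of the filtered enumeration (`bestFold_eq_argmin`, via `List.argmin_concat`);
* `evLoop_root` — one round ends at `finish π d (descentPick …)`, the pick of `Theorems/SosSandwichTransferPBDescentDefs.lean`,
  after at most `1 + 3·#(enumerated strings)` queries (`scanCost_le`);
* `evLoop_roundState`, `evLoop_means`, **`evLoop_evInit`** — with an oracle answering `true :: v` by `g v` and
  `false :: u` by `inA u`, along any invariant of paths with live levels of size `≤ B` (preserved by the picks), the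
  machine outputs `[20 ≤ meanCount g x (strWalk g x W inA D [])]` within `D·(3·W·B + 2) + 41` rounds and at every
  later fuel — the run clause of `stub_pbOracleSimulation_of_stringMachines` (`Theorems/SosSandwichTransferPBDescentWalk.lean`).

All proved; no named fact. Sources: S. Aaronson, A. Ambainis, Theory Comput. 10 (2014), proof of Thm. 23 (p. 14);
S. Arora, B. Barak, Computational Complexity (CUP 2009), §3.4.
-/

-- D-0017: single-conjunct summit ⇒ the duplicate `QuantumAdvantage.QuantumAdvantage` is mandated.
set_option linter.dupNamespace false

noncomputable section

namespace Summit.QuantumAdvantage.QuantumAdvantage.Cruxes.TransferPB.Birth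

open Finset Literature.Computability.Cryptography Literature.Computability.Complexity
  Literature.Computability.QuantumComplexity Literature.Computability.QuantumComplexity.ClassicalSimulation

namespace SimTreePB


section Semantics

variable (x : List Bool) (W : ℕ) {O : List Bool → Bool} {g inA : List Bool → Bool}

/-! ### One step -/

/-- One round of the loop at a query state. [folklore] -/
theorem evLoop_succ_of_query {s : EvState} {q : List Bool} (h : evKappa x s = Sum.inl q) (n : ℕ) :
    evLoop x W O (n + 1) s = evLoop x W O n (evDelta W s (O q)) := by
  rw [evLoop, h]

/-- The loop at an output state. [folklore] -/
theorem evLoop_done (π : List (List Bool × Bool)) (d : ℕ) (b : Bool) (n : ℕ) :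
    evLoop x W O (n + 1) ⟨π, d, .done b⟩ = some b := by
  rw [evLoop]; rfl

/-! ### Bookkeeping identities -/

/-- `levelsFrom` from no live string is empty. [folklore] -/
theorem levelsFrom_nil (blk : List Bool → Bool) : ∀ lv : ℕ, levelsFrom blk [] lv = []
  | 0 => rfl
  | lv + 1 => by rw [levelsFrom]; exact levelsFrom_nil blk lv

/-- `children` of a cons. [folklore] -/
theorem children_cons (blk : List Bool → Bool) (u : List Bool) (alive : List (List Bool)) :
    children blk (u :: alive) = ([u ++ [false], u ++ [true]].filter fun v => blk v = true) ++ children blk alive := by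
  simp [children]

/-- The two BLOCK answers for the children of `u` append exactly the live children. [folklore] -/
theorem next_children (blk : List Bool → Bool) (u : List Bool) (next : List (List Bool)) :
    (if blk (u ++ [true]) = true then (if blk (u ++ [false]) = true then next ++ [u ++ [false]] else next) ++ [u ++ [true]]
      else (if blk (u ++ [false]) = true then next ++ [u ++ [false]] else next)) =
      next ++ [u ++ [false], u ++ [true]].filter fun v => blk v = true := by
  cases h0 : blk (u ++ [false]) <;> cases h1 : blk (u ++ [true]) <;> simp [h0, h1]

/-- The levels below level `j` of the heavy-prefix descent are the next values of `liveLevel`. [folklore] -/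
theorem levelsFrom_liveLevel (blk : List Bool → Bool) :
    ∀ (lv j : ℕ), ((List.range (lv + 1)).flatMap fun i => liveLevel blk (j + i)) = levelsFrom blk (liveLevel blk j) lv
  | 0, j => by simp [levelsFrom, List.range_succ]
  | lv + 1, j => by
    have hch : children blk (liveLevel blk j) = liveLevel blk (j + 1) := rfl
    rw [levelsFrom, hch, ← levelsFrom_liveLevel blk lv (j + 1), List.range_succ_eq_map, List.flatMap_cons,
      Nat.add_zero, List.flatMap_map]
    congr 1
    refine List.flatMap_congr fun i _ => ?_
    rw [Nat.succ_eq_add_one, Nat.add_right_comm, Nat.add_assoc]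

/-- All levels `< W` of the descent, from level `0`. [folklore] -/
theorem flatMap_range_liveLevel (blk : List Bool → Bool) (w : ℕ) :
    (List.range (w + 1)).flatMap (liveLevel blk) = levelsFrom blk (liveLevel blk 0) w := by
  rw [← levelsFrom_liveLevel]
  simp only [Nat.zero_add]

/-- The scan cost is at most three queries per enumerated string. [folklore] -/
theorem scanCost_le (blk : List Bool → Bool) : ∀ (lv : ℕ) (alive : List (List Bool)),
    scanCost blk alive lv ≤ 3 * (levelsFrom blk alive lv).length
  | 0, alive => by rw [scanCost, levelsFrom]; omega
  | lv + 1, alive => by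
    rw [scanCost, levelsFrom, List.length_append]
    split_ifs with h
    · omega
    · have := scanCost_le blk lv (children blk alive)
      omega

/-- **The running least candidate is `List.argmin strNum` of the filtered enumeration.** [folklore] -/
theorem bestFold_eq_argmin (sgl : List Bool → Bool) (used : List (List Bool)) :
    ∀ (l C : List (List Bool)) (best : Option (List Bool)), best = C.argmin strNum →
      bestFold sgl used best l = (C ++ l.filter fun u => sgl u = true ∧ u ∉ used).argmin strNum
  | [], C, best, h => by simpa [bestFold] using h
  | a :: l, C, best, h => by
    rw [bestFold, List.foldl_cons, List.filter_cons]
    by_cases ha : sgl a = true ∧ a ∉ used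
    · rw [if_pos ha, if_pos (by simpa using ha)]
      have hb : better best a = (C ++ [a]).argmin strNum := by
        rw [List.argmin_concat, h]
        cases C.argmin strNum <;> rfl
      have := bestFold_eq_argmin sgl used l (C ++ [a]) (better best a) hb
      rw [bestFold] at this
      rw [this, List.append_assoc, List.singleton_append]
    · rw [if_neg ha, if_neg (by simpa using ha)]
      have := bestFold_eq_argmin sgl used l C best h
      rw [bestFold] at this
      rw [this]

/-- `bestFold` over a concatenation. [folklore] -/
theorem bestFold_append (sgl : List Bool → Bool) (used : List (List Bool)) (best : Option (List Bool))
    (l₁ l₂ : List (List Bool)) :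
    bestFold sgl used best (l₁ ++ l₂) = bestFold sgl used (bestFold sgl used best l₁) l₂ := by
  simp [bestFold, List.foldl_append]

/-! ### The level scan -/

variable (hg : ∀ v : List Bool, O (true :: v) = g v)
include hg

/-- **Scan of the last level** (no children are generated): one SINGLE query per live string. [folklore] -/
theorem evLoop_single_zero (π : List (List Bool × Bool)) (d : ℕ) (next : List (List Bool)) :
    ∀ (alive : List (List Bool)) (best : Option (List Bool)) (n : ℕ), alive ≠ [] →
      evLoop x W O (n + alive.length) ⟨π, d, .single 0 alive next best⟩ =
        evLoop x W O n (proceed π d 0 [] next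
          (bestFold (fun u => g (encSingleS x π u)) (π.map Prod.fst) best alive))
  | [], _, _, h => (h rfl).elim
  | u :: rest, best, n, _ => by
    rw [List.length_cons, ← Nat.add_assoc, evLoop_succ_of_query x W (q := true :: encSingleS x π u) rfl, hg]
    have hδ : evDelta W ⟨π, d, .single 0 (u :: rest) next best⟩ (g (encSingleS x π u)) =
        proceed π d 0 rest next (bump π (g (encSingleS x π u)) best u) := rfl
    rw [hδ]
    rcases rest with _ | ⟨w, rest⟩
    · rfl
    · have hp : proceed π d 0 (w :: rest) next (bump π (g (encSingleS x π u)) best u) =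
          ⟨π, d, .single 0 (w :: rest) next (bump π (g (encSingleS x π u)) best u)⟩ := rfl
      rw [hp, evLoop_single_zero π d next (w :: rest) _ n (List.cons_ne_nil _ _)]
      rfl

/-- **Scan of an inner level**: per live string one SINGLE query and the two BLOCK queries of its children.
[folklore] -/
theorem evLoop_single_succ (π : List (List Bool × Bool)) (d lv : ℕ) :
    ∀ (alive next : List (List Bool)) (best : Option (List Bool)) (n : ℕ), alive ≠ [] →
      evLoop x W O (n + 3 * alive.length) ⟨π, d, .single (lv + 1) alive next best⟩ =
        evLoop x W O n (proceed π d (lv + 1) [] (next ++ children (fun u => g (encBlockS x π u)) alive)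
          (bestFold (fun u => g (encSingleS x π u)) (π.map Prod.fst) best alive))
  | [], _, _, _, h => (h rfl).elim
  | u :: rest, next, best, n, _ => by
    have e : n + 3 * (u :: rest).length = n + 3 * rest.length + 1 + 1 + 1 := by simp; omega
    rw [e, evLoop_succ_of_query x W (q := true :: encSingleS x π u) rfl, hg]
    have hδ1 : evDelta W ⟨π, d, .single (lv + 1) (u :: rest) next best⟩ (g (encSingleS x π u)) =
        ⟨π, d, .block0 (lv + 1) (u :: rest) next (bump π (g (encSingleS x π u)) best u)⟩ := rfl
    rw [hδ1, evLoop_succ_of_query x W (q := true :: encBlockS x π (u ++ [false])) rfl, hg]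
    have hδ2 : evDelta W ⟨π, d, .block0 (lv + 1) (u :: rest) next (bump π (g (encSingleS x π u)) best u)⟩
        (g (encBlockS x π (u ++ [false]))) =
        ⟨π, d, .block1 (lv + 1) (u :: rest)
          (if g (encBlockS x π (u ++ [false])) = true then next ++ [u ++ [false]] else next)
          (bump π (g (encSingleS x π u)) best u)⟩ := rfl
    rw [hδ2, evLoop_succ_of_query x W (q := true :: encBlockS x π (u ++ [true])) rfl, hg]
    have hδ3 : evDelta W ⟨π, d, .block1 (lv + 1) (u :: rest)
          (if g (encBlockS x π (u ++ [false])) = true then next ++ [u ++ [false]] else next)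
          (bump π (g (encSingleS x π u)) best u)⟩ (g (encBlockS x π (u ++ [true]))) =
        proceed π d (lv + 1) rest
          (if g (encBlockS x π (u ++ [true])) = true then
            (if g (encBlockS x π (u ++ [false])) = true then next ++ [u ++ [false]] else next) ++ [u ++ [true]]
          else (if g (encBlockS x π (u ++ [false])) = true then next ++ [u ++ [false]] else next))
          (bump π (g (encSingleS x π u)) best u) := rfl
    rw [hδ3, next_children (fun v => g (encBlockS x π v)) u next]
    rcases rest with _ | ⟨w, rest⟩
    · simp [children, bestFold, bump]
    · have hp : ∀ nx bs, proceed π d (lv + 1) (w :: rest) nx bs = ⟨π, d, .single (lv + 1) (w :: rest) nx bs⟩ :=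
        fun _ _ => rfl
      rw [hp, evLoop_single_succ π d lv (w :: rest) _ _ n (List.cons_ne_nil _ _), children_cons _ u (w :: rest),
        List.append_assoc]
      rfl

/-- **The whole descent below a level**: from the live strings `alive` with `lv` levels below, the machine ends the
round's descent (`finish`) with the running least candidate over all enumerated strings, after `scanCost` queries.
[cite: AaronsonAmbainis2014, Thm. 23 (proof, p. 14)] -/
theorem evLoop_levels (π : List (List Bool × Bool)) (d : ℕ) :
    ∀ (lv : ℕ) (alive : List (List Bool)) (best : Option (List Bool)) (n : ℕ), alive ≠ [] →
      evLoop x W O (n + scanCost (fun u => g (encBlockS x π u)) alive lv) ⟨π, d, .single lv alive [] best⟩ =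
        evLoop x W O n (finish π d (bestFold (fun u => g (encSingleS x π u)) (π.map Prod.fst) best
          (levelsFrom (fun u => g (encBlockS x π u)) alive lv)))
  | 0, alive, best, n, h => by
    rw [scanCost, evLoop_single_zero x W hg π d [] alive best n h]
    rfl
  | lv + 1, alive, best, n, h => by
    rw [scanCost, levelsFrom]
    set S := (if children (fun u => g (encBlockS x π u)) alive = [] then 0
      else scanCost (fun u => g (encBlockS x π u)) (children (fun u => g (encBlockS x π u)) alive) lv) with hS
    rw [show n + (3 * alive.length + S) = (n + S) + 3 * alive.length by omega,
      evLoop_single_succ x W hg π d lv alive [] best (n + S) h, List.nil_append]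
    rcases hch : children (fun u => g (encBlockS x π u)) alive with _ | ⟨v, cs⟩
    · rw [hch, if_pos rfl] at hS
      rw [hS, levelsFrom_nil, List.append_nil]
      rfl
    · rw [hch, if_neg (List.cons_ne_nil _ _)] at hS
      have hp : proceed π d (lv + 1) [] (v :: cs) (bestFold (fun u => g (encSingleS x π u)) (π.map Prod.fst) best alive) =
          ⟨π, d, .single lv (v :: cs) [] (bestFold (fun u => g (encSingleS x π u)) (π.map Prod.fst) best alive)⟩ := rfl
      rw [hp, hS, evLoop_levels π d lv (v :: cs) _ n (List.cons_ne_nil _ _), bestFold_append]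

/-! ### A round -/

/-- **One round of the walk**: from the root state at path `π` the machine reaches `finish` at the descent's pick
`descentPick` (the `List.argmin strNum` of `descentCands`), after at most `1 + 3·#(enumerated strings)` queries.
[cite: AaronsonAmbainis2014, Thm. 23 (proof, p. 14)] -/
theorem evLoop_root (π : List (List Bool × Bool)) (d : ℕ) :
    ∃ m : ℕ, m ≤ 1 + 3 * ((List.range W).flatMap (liveLevel fun u => g (encBlockS x π u))).length ∧
      ∀ n : ℕ, evLoop x W O (n + m) ⟨π, d + 1, .root⟩ =
        evLoop x W O n (finish π (d + 1)
          (descentPick (fun u => g (encBlockS x π u)) (fun u => g (encSingleS x π u)) W (π.map Prod.fst))) := by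
  set blk : List Bool → Bool := fun u => g (encBlockS x π u) with hblk
  set sgl : List Bool → Bool := fun u => g (encSingleS x π u) with hsgl
  have hstep : ∀ n, evLoop x W O (n + 1) ⟨π, d + 1, .root⟩ =
      evLoop x W O n (if W = 0 then finish π (d + 1) none
        else if blk [] = true then ⟨π, d + 1, .single (W - 1) [[]] [] none⟩ else finish π (d + 1) none) := by
    intro n
    rw [evLoop_succ_of_query x W (q := true :: encBlockS x π []) rfl, hg]
    rfl
  rcases Nat.eq_zero_or_pos W with hW | hW
  · refine ⟨1, by omega, fun n => ?_⟩
    rw [hstep, if_pos hW, descentPick, descentCands, hW]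
    rfl
  · obtain ⟨w, rfl⟩ : ∃ w, W = w + 1 := ⟨W - 1, by omega⟩
    have hpick : descentPick blk sgl (w + 1) (π.map Prod.fst) =
        bestFold sgl (π.map Prod.fst) none (levelsFrom blk (liveLevel blk 0) w) := by
      rw [descentPick, descentCands, flatMap_range_liveLevel,
        bestFold_eq_argmin sgl (π.map Prod.fst) _ [] none (by simp), List.nil_append]
    cases h0 : blk [] with
    | false =>
      refine ⟨1, by omega, fun n => ?_⟩
      rw [hstep, if_neg (Nat.succ_ne_zero w), h0, hpick]
      have hl : liveLevel blk 0 = [] := by rw [liveLevel, h0]; rfl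
      rw [hl, levelsFrom_nil]
      rfl
    | true =>
      have hl : liveLevel blk 0 = [[]] := by rw [liveLevel, h0]; rfl
      refine ⟨1 + scanCost blk [[]] w, ?_, fun n => ?_⟩
      · have h1 := scanCost_le blk w [[]]
        rw [flatMap_range_liveLevel, hl]
        omega
      · rw [← Nat.add_assoc, show n + 1 + scanCost blk [[]] w = (n + scanCost blk [[]] w) + 1 by omega, hstep,
          if_neg (Nat.succ_ne_zero w), h0, if_pos rfl, Nat.add_sub_cancel,
          evLoop_levels x _ hg π (d + 1) w [[]] none n (List.cons_ne_nil _ _), hpick, hl]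

/-! ### The walk and the MEAN block -/

omit hg in
/-- A flat-map over a list of levels with at most `B` members each has at most `#levels · B` members. [folklore] -/
theorem length_flatMap_le_mul {B : ℕ} (f : ℕ → List (List Bool)) (hf : ∀ j, (f j).length ≤ B) :
    ∀ l : List ℕ, (l.flatMap f).length ≤ l.length * B
  | [] => by simp
  | j :: l => by
    rw [List.flatMap_cons, List.length_append, List.length_cons, Nat.succ_mul]
    have := length_flatMap_le_mul f hf l
    have := hf j
    omega

variable (hA : ∀ u : List Bool, O (false :: u) = inA u)
include hA

/-- **The walk**: from the start of a round with budget `d` at a path satisfying an invariant `Good` along which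
all live levels have at most `B` members (and which the picks preserve), the machine reaches the MEAN phase at the
final path `strWalk g x W inA d π` after at most `d · (3·W·B + 2)` queries. [cite: AaronsonAmbainis2014, Thm. 23 (proof, p. 14)] -/
theorem evLoop_roundState {B : ℕ} (Good : List (List Bool × Bool) → Prop)
    (hB : ∀ π, Good π → ∀ j : ℕ, (liveLevel (fun u => g (encBlockS x π u)) j).length ≤ B)
    (hstep : ∀ π, Good π → ∀ u : List Bool,
      descentPick (fun u => g (encBlockS x π u)) (fun u => g (encSingleS x π u)) W (π.map Prod.fst) = some u →
        Good (π ++ [(u, inA u)])) :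
    ∀ (d : ℕ) (π : List (List Bool × Bool)), Good π →
      ∃ m : ℕ, m ≤ d * (3 * (W * B) + 2) ∧
        ∀ n : ℕ, evLoop x W O (n + m) (roundState π d) = evLoop x W O n ⟨strWalk g x W inA d π, 0, .means 1 0⟩
  | 0, π, _ => ⟨0, Nat.zero_le _, fun n => rfl⟩
  | d + 1, π, hπ => by
    obtain ⟨m₁, hm₁, h₁⟩ := evLoop_root x W hg π d
    have hlen : ((List.range W).flatMap (liveLevel fun u => g (encBlockS x π u))).length ≤ W * B := by
      simpa [List.length_range] using length_flatMap_le_mul _ (hB π hπ) (List.range W)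
    have hmul : 3 * (W * B) + 2 ≤ (d + 1) * (3 * (W * B) + 2) := Nat.le_mul_of_pos_left _ (Nat.succ_pos d)
    rcases hpk : descentPick (fun u => g (encBlockS x π u)) (fun u => g (encSingleS x π u)) W (π.map Prod.fst)
      with _ | u
    · refine ⟨m₁, by omega, fun n => ?_⟩
      rw [roundState, h₁ n, hpk, finish, strWalk, hpk]
    · obtain ⟨m₂, hm₂, h₂⟩ := evLoop_roundState Good hB hstep d (π ++ [(u, inA u)]) (hstep π hπ u hpk)
      refine ⟨m₁ + 1 + m₂, ?_, fun n => ?_⟩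
      · rw [Nat.succ_mul] at hmul ⊢
        omega
      · rw [show n + (m₁ + 1 + m₂) = (n + m₂) + 1 + m₁ by omega, roundState, h₁ (n + m₂ + 1), hpk, finish,
          evLoop_succ_of_query x W (q := false :: u) rfl, hA]
        have hδ : evDelta W ⟨π, d + 1, .aq u⟩ (inA u) = roundState (π ++ [(u, inA u)]) (d + 1 - 1) := rfl
        rw [hδ, Nat.add_sub_cancel, h₂ n, strWalk, hpk]

omit hA in
/-- **The MEAN block**: from the `j`-th MEAN test with `cnt` earlier successes, `41 - j` queries lead to the output
`[20 ≤ cnt + #{j ≤ i ≤ 40 : MEAN_i answered true}]`. [cite: AaronsonAmbainis2014, Thm. 23 (proof, p. 14)] -/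
theorem evLoop_means (π : List (List Bool × Bool)) (e : ℕ) :
    ∀ (k j cnt n : ℕ), j + k = 40 →
      evLoop x W O (n + (k + 1)) ⟨π, e, .means j cnt⟩ =
        evLoop x W O n ⟨π, e, .done (decide (20 ≤ cnt +
          ((Icc j 40).filter fun i => g (encMeanS x π i) = true).card))⟩
  | 0, j, cnt, n, hj => by
    rw [← Nat.add_assoc, evLoop_succ_of_query x W (q := true :: encMeanS x π j) rfl, hg]
    have hδ : evDelta W ⟨π, e, .means j cnt⟩ (g (encMeanS x π j)) =
        ⟨π, e, .done (decide (20 ≤ (if g (encMeanS x π j) = true then cnt + 1 else cnt)))⟩ := by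
      simp only [evDelta, show 40 ≤ j by omega, if_true]
    rw [hδ, show j = 40 by omega, Finset.Icc_self, Finset.filter_singleton]
    cases g (encMeanS x π 40) <;> simp
  | k + 1, j, cnt, n, hj => by
    rw [show n + (k + 1 + 1) = (n + (k + 1)) + 1 by omega,
      evLoop_succ_of_query x W (q := true :: encMeanS x π j) rfl, hg]
    have hδ : evDelta W ⟨π, e, .means j cnt⟩ (g (encMeanS x π j)) =
        ⟨π, e, .means (j + 1) (if g (encMeanS x π j) = true then cnt + 1 else cnt)⟩ := by
      simp only [evDelta, show ¬ 40 ≤ j by omega, if_false]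
    rw [hδ, evLoop_means π e k (j + 1) _ n (by omega)]
    have hI : Icc j 40 = insert j (Icc (j + 1) 40) := (Finset.insert_Icc_add_one_left_eq_Icc (by omega)).symm
    have hnot : j ∉ (Icc (j + 1) 40).filter fun i => g (encMeanS x π i) = true := by simp
    rw [hI, Finset.filter_insert]
    cases g (encMeanS x π j) <;> simp [Finset.card_insert_of_notMem hnot, Nat.add_assoc, Nat.add_comm 1]

/-- **Runs of the event machine.** With an oracle answering `true :: v` by `g v` and `false :: u` by `inA u`, and an
invariant `Good` of paths (holding at `[]`, preserved by the picks) along which every live level of the descent has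
at most `B` members, the event machine started at `evInit D` outputs the threshold bit
`[20 ≤ meanCount g x (strWalk g x W inA D [])]` within `D · (3·W·B + 2) + 41` rounds (and at every later fuel).
[cite: AaronsonAmbainis2014, Thm. 23 (proof, p. 14)] -/
theorem evLoop_evInit {B : ℕ} (Good : List (List Bool × Bool) → Prop) (h0 : Good [])
    (hB : ∀ π, Good π → ∀ j : ℕ, (liveLevel (fun u => g (encBlockS x π u)) j).length ≤ B)
    (hstep : ∀ π, Good π → ∀ u : List Bool,
      descentPick (fun u => g (encBlockS x π u)) (fun u => g (encSingleS x π u)) W (π.map Prod.fst) = some u →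
        Good (π ++ [(u, inA u)])) (D : ℕ) :
    ∃ m : ℕ, m ≤ D * (3 * (W * B) + 2) + 41 ∧ ∀ n : ℕ, m ≤ n →
      evLoop x W O n (evInit D) = some (decide (20 ≤ meanCount g x (strWalk g x W inA D []))) := by
  obtain ⟨m, hm, hrun⟩ := evLoop_roundState x W hg hA Good hB hstep D [] h0
  refine ⟨m + 41, by omega, fun n hn => ?_⟩
  obtain ⟨n, rfl⟩ := Nat.exists_eq_add_of_le' hn
  rw [show n + (m + 41) = ((n + 1) + (39 + 1)) + m by omega, evInit, hrun,
    evLoop_means x W hg _ 0 39 1 0 (n + 1) rfl, evLoop_done, meanCount, Nat.zero_add]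

end Semantics

end SimTreePB

end Summit.QuantumAdvantage.QuantumAdvantage.Cruxes.TransferPB.Birth

end
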